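import Summits.HodgeConjecture.HodgeConjecture.Theorems.HodgeLocusCensusGrassmannianCells
import HarnessLib

/-!
# HodgeLocusCensusPlaneRank8 — PROVED: the period matrix of every coordinate 4-plane of the Fermat quartic EIGHTFOLD has rank 45 = C(8,4) − 25 (cell pub-hlocus, LEAD gen 4, (T30))
HONEST FRAMING: certified instances and evidence bearing on the general Hodge conjecture; no claim.

Companion of `HodgeLocusCensusPlaneRank` ((4,4), rank 6) and `HodgeLocusCensusPlaneRank6` ((6,4), rank 19) for the cell (8,4) of the open row r3:
the EXPLAINED component NL(Π) = {quartic eightfolds containing a ℙ⁴} has codimension h⁰(𝒪_{ℙ⁴}(4)) − dim G(5,10) = 70 − 25 = 45, and Movasati's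
matrix [p_{i+j}([Π])] (rows I₆, 2850 of them; columns I₄, 615) has first-order rank 45. Kernel-PROVED for all 1024 coordinate 4-planes
Π = V(x_{2e} − ζ^{2a_{2e+1}+1}x_{2e+1}, e = 0..4) (b = id): `ivhsRankEq_plane84 (a₁ a₃ a₅ a₇ a₉) : IvhsRankEq 8 4 45 [(1, plane84 a₁ a₃ a₅ a₇ a₉)]`,
over every field of characteristic 0 and every primitive 8th root ζ; as a corollary the typed census row `rankPiPrime_8_4` of
`HodgeLocusCensusGrassmannianCells` (Π′ = `piPrime8 = plane84 0 0 1 0 0`) HOLDS. MECHANISM (proved, `ivhsMatrix_plane84_eq_mul`): by `period_plane84`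
the entry (i,j) is nonzero iff the five pair sums of i + j are all 2, and then splits as ζ^{Σ i_{2e}c_e} · ζ^{Σ (j_{2e}+1)c_e}; a row whose pair-sum
type has a coordinate > 2 is zero, the others fall into the 45 types σ ∈ {0,1,2}⁵ with |σ| = 6 (the coefficient of x⁶ in (1+x+x²)⁵) — so M = U · V
through K⁴⁵ (rank ≤ 45), and the 45 × 45 minor on the rows x^{(σ₀,0,σ₁,0,…,σ₄,0)} and columns x^{(2−σ₀,0,…,2−σ₄,0)} is DIAGONAL with unit entries
(rank ≥ 45). Numerics of record: engine A exact (T18d) = B = R34(c): 45.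
-/

namespace Summit.HodgeConjecture.HodgeConjecture.HodgeLocus.Census.PlaneRank8
open GrSection

/-- MV18 Thm 1 for a coordinate 4-plane of X⁴₈ (b = id): p_i(Π) = ζ^{Σ_e (i_{2e}+1)(1+2a_{2e+1})} if every pair sum i_{2e} + i_{2e+1} is 2, else 0. -/
theorem period_plane84 {K : Type*} [Field K] (ζ : K) (a1 a3 a5 a7 a9 : ℕ) (i : Fin 10 → ℕ) :
    period 8 4 ζ (plane84 a1 a3 a5 a7 a9) i =
      if i 0 + i 1 = 2 ∧ i 2 + i 3 = 2 ∧ i 4 + i 5 = 2 ∧ i 6 + i 7 = 2 ∧ i 8 + i 9 = 2 then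
        ζ ^ ((i 0 + 1) * (1 + 2 * a1) + (i 2 + 1) * (1 + 2 * a3) + (i 4 + 1) * (1 + 2 * a5) + (i 6 + 1) * (1 + 2 * a7) +
          (i 8 + 1) * (1 + 2 * a9)) else 0 := by
  unfold period plane84
  simp only [Equiv.Perm.coe_one, id_eq, Equiv.Perm.sign_one, Units.val_one, Int.cast_one, one_mul]
  have hc : (∀ e : Fin (8 / 2 + 1), i ⟨2 * (e : ℕ), by omega⟩ + i ⟨2 * (e : ℕ) + 1, by omega⟩ = 4 - 2) ↔
      (i 0 + i 1 = 2 ∧ i 2 + i 3 = 2 ∧ i 4 + i 5 = 2 ∧ i 6 + i 7 = 2 ∧ i 8 + i 9 = 2) := by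
    simp [Fin.forall_fin_succ]
  have hs : (∑ e : Fin (8 / 2 + 1), (i ⟨2 * (e : ℕ), by omega⟩ + 1) *
        (1 + 2 * (![0, a1, 0, a3, 0, a5, 0, a7, 0, a9] : Fin 10 → ℕ) ⟨2 * (e : ℕ) + 1, by omega⟩))
      = (i 0 + 1) * (1 + 2 * a1) + (i 2 + 1) * (1 + 2 * a3) + (i 4 + 1) * (1 + 2 * a5) + (i 6 + 1) * (1 + 2 * a7) +
          (i 8 + 1) * (1 + 2 * a9) := by
    simp [Fin.sum_univ_succ]
    ring
  simp only [hc, hs]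

/-- the 45 pair-sum types σ ∈ {0,1,2}⁵, |σ| = 6, of a nonzero row (lexicographic), coordinate 0. -/
def sig0 : Fin 45 → ℕ := ![0, 0, 0, 0, 0, 0, 0, 0, 0, 0, 1, 1, 1, 1, 1, 1, 1, 1, 1, 1, 1, 1, 1, 1, 1, 1, 2, 2, 2, 2, 2, 2, 2, 2, 2, 2, 2, 2, 2, 2, 2, 2, 2, 2, 2]
/-- the 45 pair-sum types σ ∈ {0,1,2}⁵, |σ| = 6, of a nonzero row (lexicographic), coordinate 1. -/
def sig1 : Fin 45 → ℕ := ![0, 1, 1, 1, 2, 2, 2, 2, 2, 2, 0, 0, 0, 1, 1, 1, 1, 1, 1, 2, 2, 2, 2, 2, 2, 2, 0, 0, 0, 0, 0, 0, 1, 1, 1, 1, 1, 1, 1, 2, 2, 2, 2, 2, 2]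
/-- the 45 pair-sum types σ ∈ {0,1,2}⁵, |σ| = 6, of a nonzero row (lexicographic), coordinate 2. -/
def sig2 : Fin 45 → ℕ := ![2, 1, 2, 2, 0, 1, 1, 2, 2, 2, 1, 2, 2, 0, 1, 1, 2, 2, 2, 0, 0, 1, 1, 1, 2, 2, 0, 1, 1, 2, 2, 2, 0, 0, 1, 1, 1, 2, 2, 0, 0, 0, 1, 1, 2]
/-- the 45 pair-sum types σ ∈ {0,1,2}⁵, |σ| = 6, of a nonzero row (lexicographic), coordinate 3. -/
def sig3 : Fin 45 → ℕ := ![2, 2, 1, 2, 2, 1, 2, 0, 1, 2, 2, 1, 2, 2, 1, 2, 0, 1, 2, 1, 2, 0, 1, 2, 0, 1, 2, 1, 2, 0, 1, 2, 1, 2, 0, 1, 2, 0, 1, 0, 1, 2, 0, 1, 0]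
/-- the 45 pair-sum types σ ∈ {0,1,2}⁵, |σ| = 6, of a nonzero row (lexicographic), coordinate 4. -/
def sig4 : Fin 45 → ℕ := ![2, 2, 2, 1, 2, 2, 1, 2, 1, 0, 2, 2, 1, 2, 2, 1, 2, 1, 0, 2, 1, 2, 1, 0, 1, 0, 2, 2, 1, 2, 1, 0, 2, 1, 2, 1, 0, 1, 0, 2, 1, 0, 1, 0, 0]

/-- the 45 types are distinct … -/
theorem sig_inj : ∀ k k' : Fin 45, sig0 k = sig0 k' → sig1 k = sig1 k' → sig2 k = sig2 k' → sig3 k = sig3 k' → sig4 k = sig4 k' → k = k' := by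
  decide

/-- … have coordinates ≤ 2 … -/
theorem sig_le : ∀ k : Fin 45, sig0 k ≤ 2 ∧ sig1 k ≤ 2 ∧ sig2 k ≤ 2 ∧ sig3 k ≤ 2 ∧ sig4 k ≤ 2 := by decide

/-- … sum to 6 … -/
theorem sig_sum : ∀ k : Fin 45, sig0 k + sig1 k + sig2 k + sig3 k + sig4 k = 6 := by decide

set_option synthInstance.maxSize 1024 in
set_option synthInstance.maxHeartbeats 400000 in
/-- … and exhaust {σ ∈ {0,1,2}⁵ : |σ| = 6}. -/
theorem sig_cover : ∀ s0 s1 s2 s3 s4 : Fin 3, (s0 : ℕ) + s1 + s2 + s3 + s4 = 6 →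
    ∃ k : Fin 45, (s0 : ℕ) = sig0 k ∧ (s1 : ℕ) = sig1 k ∧ (s2 : ℕ) = sig2 k ∧ (s3 : ℕ) = sig3 k ∧ (s4 : ℕ) = sig4 k := by decide

/-- unbounded form of the cover. -/
theorem sig_cover' (s0 s1 s2 s3 s4 : ℕ) (h0 : s0 ≤ 2) (h1 : s1 ≤ 2) (h2 : s2 ≤ 2) (h3 : s3 ≤ 2) (h4 : s4 ≤ 2) (h : s0 + s1 + s2 + s3 + s4 = 6) :
    ∃ k : Fin 45, s0 = sig0 k ∧ s1 = sig1 k ∧ s2 = sig2 k ∧ s3 = sig3 k ∧ s4 = sig4 k :=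
  sig_cover ⟨s0, by omega⟩ ⟨s1, by omega⟩ ⟨s2, by omega⟩ ⟨s3, by omega⟩ ⟨s4, by omega⟩ h

/-- left factor U (rows × 45). -/
noncomputable def factorU {K : Type*} [Field K] (ζ : K) (a1 a3 a5 a7 a9 : ℕ) : Matrix (indexSet 8 4 (8 / 2 * 4 - 8 - 2)) (Fin 45) K :=
  fun i k => if i.1 0 + i.1 1 = sig0 k ∧ i.1 2 + i.1 3 = sig1 k ∧ i.1 4 + i.1 5 = sig2 k ∧ i.1 6 + i.1 7 = sig3 k ∧ i.1 8 + i.1 9 = sig4 k then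
    ζ ^ (i.1 0 * (1 + 2 * a1) + i.1 2 * (1 + 2 * a3) + i.1 4 * (1 + 2 * a5) + i.1 6 * (1 + 2 * a7) + i.1 8 * (1 + 2 * a9)) else 0

/-- right factor V (45 × columns). -/
noncomputable def factorV {K : Type*} [Field K] (ζ : K) (a1 a3 a5 a7 a9 : ℕ) : Matrix (Fin 45) (indexSet 8 4 4) K :=
  fun k j => if sig0 k + (j.1 0 + j.1 1) = 2 ∧ sig1 k + (j.1 2 + j.1 3) = 2 ∧ sig2 k + (j.1 4 + j.1 5) = 2 ∧ sig3 k + (j.1 6 + j.1 7) = 2 ∧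
      sig4 k + (j.1 8 + j.1 9) = 2 then
    ζ ^ ((j.1 0 + 1) * (1 + 2 * a1) + (j.1 2 + 1) * (1 + 2 * a3) + (j.1 4 + 1) * (1 + 2 * a5) + (j.1 6 + 1) * (1 + 2 * a7) +
      (j.1 8 + 1) * (1 + 2 * a9)) else 0

/-- the total degree of a row index is 6. -/
theorem row_sum (i : Fin 10 → ℕ) (hi : i ∈ indexSet 8 4 (8 / 2 * 4 - 8 - 2)) :
    i 0 + i 1 + i 2 + i 3 + i 4 + i 5 + i 6 + i 7 + i 8 + i 9 = 6 := by
  have h := (Finset.mem_filter.mp hi).2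
  rw [Finset.sum_fin_eq_sum_range] at h
  simp [Finset.sum_range_succ] at h
  omega

/-- STRUCTURE THEOREM: M_[Π] = U · V through K⁴⁵ (block-diagonal in the pair-sum type; rank-one blocks; rows of a type with a coordinate > 2 vanish). -/
theorem ivhsMatrix_plane84_eq_mul {K : Type*} [Field K] (ζ : K) (a1 a3 a5 a7 a9 : ℕ) :
    ivhsMatrix 8 4 ζ [(1, plane84 a1 a3 a5 a7 a9)] = factorU ζ a1 a3 a5 a7 a9 * factorV ζ a1 a3 a5 a7 a9 := by
  ext ⟨i, hi⟩ ⟨j, hj⟩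
  rw [Matrix.mul_apply]
  by_cases hex : ∃ k : Fin 45, i 0 + i 1 = sig0 k ∧ i 2 + i 3 = sig1 k ∧ i 4 + i 5 = sig2 k ∧ i 6 + i 7 = sig3 k ∧ i 8 + i 9 = sig4 k
  · obtain ⟨k₀, h0, h1, h2, h3, h4⟩ := hex
    rw [Finset.sum_eq_single k₀]
    · unfold ivhsMatrix periodComb factorU factorV
      simp only [List.map, List.sum_cons, List.sum_nil, Rat.cast_one, one_mul, add_zero, period_plane84]
      rw [if_pos (show i 0 + i 1 = sig0 k₀ ∧ i 2 + i 3 = sig1 k₀ ∧ i 4 + i 5 = sig2 k₀ ∧ i 6 + i 7 = sig3 k₀ ∧ i 8 + i 9 = sig4 k₀ from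
          ⟨h0, h1, h2, h3, h4⟩)]
      by_cases hc : sig0 k₀ + (j 0 + j 1) = 2 ∧ sig1 k₀ + (j 2 + j 3) = 2 ∧ sig2 k₀ + (j 4 + j 5) = 2 ∧ sig3 k₀ + (j 6 + j 7) = 2 ∧
          sig4 k₀ + (j 8 + j 9) = 2
      · obtain ⟨c0, c1, c2, c3, c4⟩ := hc
        rw [if_pos (show sig0 k₀ + (j 0 + j 1) = 2 ∧ sig1 k₀ + (j 2 + j 3) = 2 ∧ sig2 k₀ + (j 4 + j 5) = 2 ∧ sig3 k₀ + (j 6 + j 7) = 2 ∧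
            sig4 k₀ + (j 8 + j 9) = 2 from ⟨c0, c1, c2, c3, c4⟩),
          if_pos (show i 0 + j 0 + (i 1 + j 1) = 2 ∧ i 2 + j 2 + (i 3 + j 3) = 2 ∧ i 4 + j 4 + (i 5 + j 5) = 2 ∧
              i 6 + j 6 + (i 7 + j 7) = 2 ∧ i 8 + j 8 + (i 9 + j 9) = 2 from
            ⟨by omega, by omega, by omega, by omega, by omega⟩), ← pow_add]
        congr 1
        ring
      · rw [if_neg hc, if_neg (show ¬ (i 0 + j 0 + (i 1 + j 1) = 2 ∧ i 2 + j 2 + (i 3 + j 3) = 2 ∧ i 4 + j 4 + (i 5 + j 5) = 2 ∧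
            i 6 + j 6 + (i 7 + j 7) = 2 ∧ i 8 + j 8 + (i 9 + j 9) = 2) from
          fun h => hc ⟨by omega, by omega, by omega, by omega, by omega⟩)]
        simp
    · intro k _ hk
      unfold factorU
      rw [if_neg, zero_mul]
      intro h
      exact hk (sig_inj k k₀ (h.1.symm.trans h0) (h.2.1.symm.trans h1) (h.2.2.1.symm.trans h2) (h.2.2.2.1.symm.trans h3)
        (h.2.2.2.2.symm.trans h4))
    · intro h
      exact absurd (Finset.mem_univ k₀) h
  · -- a row of a type with some pair sum > 2: both sides vanish
    have hsum := row_sum i hi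
    have hU : ∀ k, factorU ζ a1 a3 a5 a7 a9 ⟨i, hi⟩ k = 0 := fun k => by
      unfold factorU
      exact if_neg (fun h => hex ⟨k, h⟩)
    rw [Finset.sum_eq_zero (fun k _ => by rw [hU k, zero_mul])]
    unfold ivhsMatrix periodComb
    simp only [List.map, List.sum_cons, List.sum_nil, Rat.cast_one, one_mul, add_zero, period_plane84]
    rw [if_neg]
    intro hc
    obtain ⟨c0, c1, c2, c3, c4⟩ := hc
    exact hex (sig_cover' (i 0 + i 1) (i 2 + i 3) (i 4 + i 5) (i 6 + i 7) (i 8 + i 9) (by omega) (by omega) (by omega) (by omega)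
      (by omega) (by omega))

/-- UPPER BOUND: rank M_[Π] ≤ 45. -/
theorem rank_le_fortyfive {K : Type*} [Field K] (ζ : K) (a1 a3 a5 a7 a9 : ℕ) :
    (ivhsMatrix 8 4 ζ [(1, plane84 a1 a3 a5 a7 a9)]).rank ≤ 45 := by
  rw [ivhsMatrix_plane84_eq_mul]
  exact (Matrix.rank_mul_le_left _ _).trans (by simpa using Matrix.rank_le_card_width (factorU ζ a1 a3 a5 a7 a9))

/-- the witness rows x^{(σ₀,0,σ₁,0,σ₂,0,σ₃,0,σ₄,0)} lie in I₆ … -/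
theorem rowPick_mem (a : Fin 45) :
    (![sig0 a, 0, sig1 a, 0, sig2 a, 0, sig3 a, 0, sig4 a, 0] : Fin 10 → ℕ) ∈ indexSet 8 4 (8 / 2 * 4 - 8 - 2) := by
  obtain ⟨l0, l1, l2, l3, l4⟩ := sig_le a
  have hs := sig_sum a
  unfold indexSet
  simp only [Finset.mem_filter, Fintype.mem_piFinset, Finset.mem_range, Fin.forall_fin_succ, Fin.sum_univ_succ]
  simp
  omega

/-- … and so do the witness columns x^{(2−σ₀,0,…,2−σ₄,0)} in I₄. -/
theorem colPick_mem (a : Fin 45) :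
    (![2 - sig0 a, 0, 2 - sig1 a, 0, 2 - sig2 a, 0, 2 - sig3 a, 0, 2 - sig4 a, 0] : Fin 10 → ℕ) ∈ indexSet 8 4 4 := by
  obtain ⟨l0, l1, l2, l3, l4⟩ := sig_le a
  have hs := sig_sum a
  unfold indexSet
  simp only [Finset.mem_filter, Fintype.mem_piFinset, Finset.mem_range, Fin.forall_fin_succ, Fin.sum_univ_succ]
  simp
  omega

/-- the 45 witness rows … -/
def rowPick (a : Fin 45) : indexSet 8 4 (8 / 2 * 4 - 8 - 2) := ⟨![sig0 a, 0, sig1 a, 0, sig2 a, 0, sig3 a, 0, sig4 a, 0], rowPick_mem a⟩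

/-- … and the 45 witness columns (complementary types). -/
def colPick (a : Fin 45) : indexSet 8 4 4 := ⟨![2 - sig0 a, 0, 2 - sig1 a, 0, 2 - sig2 a, 0, 2 - sig3 a, 0, 2 - sig4 a, 0], colPick_mem a⟩

/-- the 45 × 45 witness minor is diagonal: off-diagonal entries vanish … -/
theorem minor_offdiag {K : Type*} [Field K] (ζ : K) (a1 a3 a5 a7 a9 : ℕ) (a b : Fin 45) (hab : a ≠ b) :
    ivhsMatrix 8 4 ζ [(1, plane84 a1 a3 a5 a7 a9)] (rowPick a) (colPick b) = 0 := by
  unfold ivhsMatrix periodComb rowPick colPick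
  simp only [List.map, List.sum_cons, List.sum_nil, Rat.cast_one, one_mul, add_zero, period_plane84,
    Matrix.cons_val_zero, Matrix.cons_val_one, Matrix.cons_val]
  rw [if_neg]
  intro hc
  obtain ⟨c0, c1, c2, c3, c4⟩ := hc
  obtain ⟨la0, la1, la2, la3, la4⟩ := sig_le a
  obtain ⟨lb0, lb1, lb2, lb3, lb4⟩ := sig_le b
  exact hab (sig_inj a b (by omega) (by omega) (by omega) (by omega) (by omega))

/-- … and the diagonal entries are powers of ζ, hence nonzero. -/
theorem minor_diag_ne_zero {K : Type*} [Field K] (ζ : K) (hz : ζ ≠ 0) (a1 a3 a5 a7 a9 : ℕ) (a : Fin 45) :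
    ivhsMatrix 8 4 ζ [(1, plane84 a1 a3 a5 a7 a9)] (rowPick a) (colPick a) ≠ 0 := by
  unfold ivhsMatrix periodComb rowPick colPick
  simp only [List.map, List.sum_cons, List.sum_nil, Rat.cast_one, one_mul, add_zero, period_plane84,
    Matrix.cons_val_zero, Matrix.cons_val_one, Matrix.cons_val]
  obtain ⟨la0, la1, la2, la3, la4⟩ := sig_le a
  rw [if_pos ⟨by omega, by omega, by omega, by omega, by omega⟩]
  exact pow_ne_zero _ hz

/-- LOWER BOUND: rank M_[Π] ≥ 45 (the witness minor is a unit). -/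
theorem fortyfive_le_rank {K : Type*} [Field K] (ζ : K) (hz : ζ ≠ 0) (a1 a3 a5 a7 a9 : ℕ) :
    45 ≤ (ivhsMatrix 8 4 ζ [(1, plane84 a1 a3 a5 a7 a9)]).rank := by
  classical
  set M := ivhsMatrix 8 4 ζ [(1, plane84 a1 a3 a5 a7 a9)] with hM
  have hS : M.submatrix rowPick colPick = Matrix.diagonal (fun a => M (rowPick a) (colPick a)) := by
    ext a b
    by_cases hab : a = b
    · subst hab
      rw [Matrix.diagonal_apply_eq, Matrix.submatrix_apply]
    · rw [Matrix.diagonal_apply_ne _ hab, Matrix.submatrix_apply]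
      exact minor_offdiag ζ a1 a3 a5 a7 a9 a b hab
  have hdet : IsUnit (M.submatrix rowPick colPick).det := by
    rw [hS, Matrix.det_diagonal]
    exact isUnit_iff_ne_zero.mpr (Finset.prod_ne_zero_iff.mpr fun a _ => minor_diag_ne_zero ζ hz a1 a3 a5 a7 a9 a)
  have hrank : (M.submatrix rowPick colPick).rank = 45 := by
    rw [Matrix.rank_of_isUnit _ ((Matrix.isUnit_iff_isUnit_det _).mpr hdet), Fintype.card_fin]
  calc 45 = (M.submatrix rowPick colPick).rank := hrank.symm
    _ ≤ M.rank := Matrix.rank_submatrix_le M rowPick colPick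

/-- PROVED ROW (all 1024 coordinate 4-planes of the Fermat quartic eightfold): `IvhsRankEq 8 4 45 [Π]` — the first-order Hodge locus of a ℙ⁴ has
codimension 45 = 70 − 25 = codim {X ⊃ Π}. -/
theorem ivhsRankEq_plane84 (a1 a3 a5 a7 a9 : ℕ) : IvhsRankEq 8 4 45 [(1, plane84 a1 a3 a5 a7 a9)] := by
  intro K _ _ ζ hζ
  exact le_antisymm (rank_le_fortyfive ζ a1 a3 a5 a7 a9) (fortyfive_le_rank ζ (hζ.ne_zero (by norm_num)) a1 a3 a5 a7 a9)

/-- the census row `rankPiPrime_8_4` of `HodgeLocusCensusGrassmannianCells` HOLDS: rank M_Π′ = 45 on X⁴₈. -/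
theorem rankPiPrime_8_4_holds : rankPiPrime_8_4 := by
  unfold rankPiPrime_8_4 piPrime8
  exact ivhsRankEq_plane84 0 0 1 0 0

/-- the count 45 = C(8,4) − 5·5 = #{σ ∈ {0,1,2}⁵ : |σ| = 6} = Σ_k C(5,k)·C(5−k, 6−2k) (k twos). -/
theorem plane84_codim_count : Nat.choose 8 4 - 5 * 5 = 45 ∧ 5 * Nat.choose 4 4 + 10 * Nat.choose 3 2 + 10 * Nat.choose 2 0 = 45 := by decide

end Summit.HodgeConjecture.HodgeConjecture.HodgeLocus.Census.PlaneRank8
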